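import Literature.Barriers.BirchSwinnertonDyer.PAdicFunctionalEquationParityLambdaTwoProofs
import Summits.BirchSwinnertonDyer.Rank1Residual.F1Sign2.OddEvenCongruenceAtTwo
import HarnessLib

/-!
# Cell `bsd-f1-sign2`, IMC lens (planner-of-record -imc g2, MEMO-imc §10.22): PARITY(2) on the ODD branch
# and the parity shadow of `OddEvenCongruenceAtTwo` — statement only (`@[conjecture] def` + proved glue)

STATEMENTS ONLY: one `@[conjecture] def` (IMC-PAR⁻ `OrdinaryOddBranchLambdaParityAtTwo`, a SUPPORT-grade open obligation
of ours — expected from the printed Mazur–Tate–Teitelbaum functional equation of the `ω`-branch, i.e. in-print-assembly,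
NOT a new conjecture of substance) and two PROVED glue theorems; nothing asserted, no `sorry`, no named fact.

DATA (D-imc-7/8/9, ENGINE D2, pre-registered P9 / PAR2 in folder `dimc9/NOTES.md`): on every stable
good-ordinary or multiplicative row of the census, the prime-twist census and the ON-stratum partner
census, BOTH the even (`ω⁰`) and the `ω`-odd `2`-adic branches satisfy `(−1)^λ = χ₈(M)`, `M` the odd
part of the conductor: plus 1 419/1 419, minus 1 431/1 431 branch instances, 0 misses; consequently the
λ-move of any mod-2 congruent pair minus its Matsuno `Σe` is even (8 558/8 558) and `λ⁺ ≡ λ⁻ (mod 2)`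
on every row (84 rows with `λ⁺ ≠ λ⁻`, all differences even).

TREE: the EVEN-branch law is PROVED —
`Literature.Barriers.BirchSwinnertonDyer.even_firstUnitCoeff_iff_conductorNorm_mod_eight` (good ordinary
at `2`; Greenberg LNM 1716 §1/§5 p. 181: at `p = 2` the involution `T ↦ (1+T)⁻¹ − 1` has the second fixed
point `T = −2`) and `even_firstUnitCoeff_iff_oddLevel_mod_eight_of_isSplitMultPAdicLFunctionOf` /
`…_of_isMultPAdicLFunctionOf_neg_one` (multiplicative at `2`). The ODD (`ω¹`) branch is NOT covered: the
tree has no functional equation for `padicLFunctionMinusBranch f α 1` (Mazur–Tate–Teitelbaum 1986 §I.17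
states the functional equation for the twisted branches; at `p = 2`, `ω = χ₋₄ = ω⁻¹`, so the `ω`-branch is
SELF-dual under `ι` and the same coefficient comparison should give `λ⁻ ≡ c (mod 2)` with `⟨N_E⟩ = 5^c`).

This file: `@[conjecture] def OrdinaryOddBranchLambdaParityAtTwo` = the odd-branch law in EXACTLY the shape of the
tree's even-branch theorem (first-unit-coefficient language, any normalising scalar `t`), and the proved
glue `even_iff_even_of_ordinaryOddBranchLambdaParityAtTwo`: granted it, the even- and odd-branch λ-invariants of a
good-ordinary curve have the SAME PARITY — the universal (no `Δ < 0`, no torsion hypothesis) parity shadow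
of the candidate `OddEvenCongruenceAtTwo` (`CongruentBranches ⇒ red (pfree Gp) = red (pfree Gm) ⇒ λ⁺ = λ⁻`),
i.e. a first rung that is a theorem-candidate rather than a conjecture. Nothing asserted; no named fact.

NAME. The sketch's name `OddBranchLambdaParityAtTwo` is TAKEN in the tree by AN-6P (`BlindOrderOddBranchAtTwo.lean`:
the good-SUPERSINGULAR odd-branch parity of the Sprung pair `(L♯₋, L♭₋)`); this good-ORDINARY statement is therefore
filed as `OrdinaryOddBranchLambdaParityAtTwo` (REF1 §26 (3)); the two are the ordinary / supersingular halves of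
«`(−1)^{λ⁻} = ±χ₈(N)` on the `ω`-branch».

REFUTER VERDICTS: REF1-AUDIT-v1 §26 (3) (g4, ab5d8d85b9fc0770): SURVIVES support-grade («`n = λ⁻` is pinned by the norm
hypotheses, fine»; rename required — done here). REF2-PLACEMENT-v11 (464e06f94986d43c): IN-PRINT-ASSEMBLY — the
`ω`-branch functional equation at `(p, i) = (2, 1)` is Mazur–Tate–Teitelbaum 1986 §I.17 (quoted for every root `α` and
every `ω^i` in the proof of Sprung 2017 Thm 4.13), plus Greenberg LNM 1716 §5 p. 181 (the second fixed point `T = −2` at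
`p = 2`) and the tree's core lemma `PAdicFunctionalEquationParityLambdaTwoProofs`; beyond-print theorem: NO; a prover
item, not a conjecture of substance.

TYPER FILING (seat `bsd-f1-sign2-ty` g2; CANDIDATES.md row IMC-PAR⁻): bodies VERBATIM from
`HOME/MEMO-imc-data/SketchG2-Parity-v1.lean` 68c4b59823d3e881 (rc 0, 0 sorry) with the single rename above (and the
matching glue-theorem rename); cite tag `[cite: Sprung2017, Thm. 4.13 (proof)]` added per REF2 v11 §4. PARTITION: none
moved; beyond-print theorem: no. bears_on: F1 leaf 19097/19098 (parity rung of `OddEvenCongruenceAtTwo`).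
-/

noncomputable section

open scoped Classical MatrixGroups ModularForm

open CongruenceSubgroup PowerSeries WeierstrassCurve Literature.NumberTheory.EllipticCurves
  Literature.NumberTheory.EllipticCurves.ModularForms Literature.Barriers.BirchSwinnertonDyer

namespace Summit.BirchSwinnertonDyer.Rank1Residual.F1Sign2

/-- **Candidate IMC-PAR⁻ `OrdinaryOddBranchLambdaParityAtTwo` (support-grade; expected from the Mazur–Tate–Teitelbaum
functional equation of the `ω`-branch, NOT in the tree).** For `E = W/ℚ` globally minimal, good ORDINARY at
`2`, `f` its newform at level `N_E`, `L⁻ = L₂(f, α, ω¹, T)` (`padicLFunctionMinusBranch f α 1`, `α` the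
unit root) and any scalar `t ∈ ℚ₂` with `t · L⁻` `2`-integral: if `n` is the index of the first UNIT
coefficient of `t · L⁻` (for `t = 2^{−μ}` this is `λ⁻`), then `n` is even iff `N_E ≡ ±1 (mod 8)` —
`(−1)^{λ⁻} = χ₈(N_E)`, the root numbers do not enter. Twin of the PROVED even-branch theorem
`even_firstUnitCoeff_iff_conductorNorm_mod_eight`. Evidence: 386/386 good-ordinary + 1 045/1 045
multiplicative stable odd-branch instances (D-imc-7/8/9). Why it might fail: only through the junk value
of `padicLFunctionMinusBranch` where the minus Riemann sums do not converge (the port REF1 §3 names for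
K1), or a sign/multiplier of the `ω`-branch functional equation at `2` differing from the even one.
REF1 §26 (3): SURVIVES support-grade; REF2 v11: in-print-assembly (MTT §I.17 via Sprung 2017 Thm 4.13's proof).
[cite: MazurTateTeitelbaum1986Invent, §I.17 (functional equation); GreenbergLNM1716, §5 p. 181]
[cite: Sprung2017, Thm. 4.13 (proof)] -/
@[conjecture] def OrdinaryOddBranchLambdaParityAtTwo : Prop :=
  ∀ (W : WeierstrassCurve ℚ) [W.IsElliptic] [W.IsGloballyMinimal] [NeZero (W.conductorNorm ℤ)]
    (f : CuspForm (Gamma0 (W.conductorNorm ℤ)) 2), IsOrdinaryAt W 2 → IsNewformOf W f →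
    ∀ (t : ℚ_[2]) (n : ℕ),
      (∀ k, ‖coeff k (C t * padicLFunctionMinusBranch f (unitRoot W 2 : ℚ_[2]) 1)‖ ≤ 1) →
      (∀ j < n, ‖coeff j (C t * padicLFunctionMinusBranch f (unitRoot W 2 : ℚ_[2]) 1)‖ ≤ 2⁻¹) →
      ‖coeff n (C t * padicLFunctionMinusBranch f (unitRoot W 2 : ℚ_[2]) 1)‖ = 1 →
      (Even n ↔ (W.conductorNorm ℤ % 8 = 1 ∨ W.conductorNorm ℤ % 8 = 7))

/-- **Glue (PROVED): the parity shadow of `OddEvenCongruenceAtTwo`.** Granting `OrdinaryOddBranchLambdaParityAtTwo`,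
for a good-ordinary curve the first unit coefficients `n⁺` of `t⁺ · L₂(f, α, T)` and `n⁻` of
`t⁻ · L₂(f, α, ω, T)` (any normalising scalars) have the same parity — by the tree's even-branch theorem both
parities equal `[N_E ≡ ±1 (mod 8)]`. No `Δ < 0` / no-`2`-torsion hypothesis: this is the part of the
odd–even congruence that the functional equations alone deliver. [cite: GreenbergLNM1716, §5 p. 181] -/
theorem even_iff_even_of_ordinaryOddBranchLambdaParityAtTwo (h : OrdinaryOddBranchLambdaParityAtTwo)
    {W : WeierstrassCurve ℚ} [W.IsElliptic] [W.IsGloballyMinimal] [NeZero (W.conductorNorm ℤ)]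
    {f : CuspForm (Gamma0 (W.conductorNorm ℤ)) 2} (hord : IsOrdinaryAt W 2) (hf : IsNewformOf W f)
    (tp tm : ℚ_[2]) {np nm : ℕ}
    (hintp : ∀ k, ‖coeff k (C tp * padicLFunction f (unitRoot W 2 : ℚ_[2]))‖ ≤ 1)
    (hsmallp : ∀ j < np, ‖coeff j (C tp * padicLFunction f (unitRoot W 2 : ℚ_[2]))‖ ≤ 2⁻¹)
    (hunitp : ‖coeff np (C tp * padicLFunction f (unitRoot W 2 : ℚ_[2]))‖ = 1)
    (hintm : ∀ k, ‖coeff k (C tm * padicLFunctionMinusBranch f (unitRoot W 2 : ℚ_[2]) 1)‖ ≤ 1)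
    (hsmallm : ∀ j < nm, ‖coeff j (C tm * padicLFunctionMinusBranch f (unitRoot W 2 : ℚ_[2]) 1)‖ ≤ 2⁻¹)
    (hunitm : ‖coeff nm (C tm * padicLFunctionMinusBranch f (unitRoot W 2 : ℚ_[2]) 1)‖ = 1) :
    (Even np ↔ Even nm) :=
  (even_firstUnitCoeff_iff_conductorNorm_mod_eight hord hf tp hintp hsmallp hunitp).trans
    (h W f hord hf tm nm hintm hsmallm hunitm).symm

/-- **Glue (PROVED): along a mod-`2` congruence the even-branch λ-parities move by `χ₈`** — for two
good-ordinary curves `W₁, W₂` (any levels), the first unit coefficients of their normalised `2`-adic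
`L`-functions have the same parity iff `χ₈(N₁) = χ₈(N₂)`, i.e. iff `N₁ N₂ ≡ ±1 (mod 8)`; this is the
theorem behind the census regularity «λ-move − Σe even» (the odd Matsuno e-terms are exactly those of the
primes `ℓ ≡ ±3 (mod 8)` multiplicative for one curve only). Pure consequence of the tree's even-branch
PARITY(2) theorem; recorded as the alignment-free part of `AnalyticLineTransferAtTwo`.
[cite: GreenbergLNM1716, §5 p. 181] -/
theorem even_iff_even_of_conductors_mod_eight
    {W₁ : WeierstrassCurve ℚ} [W₁.IsElliptic] [W₁.IsGloballyMinimal] [NeZero (W₁.conductorNorm ℤ)]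
    {W₂ : WeierstrassCurve ℚ} [W₂.IsElliptic] [W₂.IsGloballyMinimal] [NeZero (W₂.conductorNorm ℤ)]
    {f₁ : CuspForm (Gamma0 (W₁.conductorNorm ℤ)) 2} {f₂ : CuspForm (Gamma0 (W₂.conductorNorm ℤ)) 2}
    (hord₁ : IsOrdinaryAt W₁ 2) (hf₁ : IsNewformOf W₁ f₁) (hord₂ : IsOrdinaryAt W₂ 2) (hf₂ : IsNewformOf W₂ f₂)
    (t₁ t₂ : ℚ_[2]) {n₁ n₂ : ℕ}
    (hint₁ : ∀ k, ‖coeff k (C t₁ * padicLFunction f₁ (unitRoot W₁ 2 : ℚ_[2]))‖ ≤ 1)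
    (hsmall₁ : ∀ j < n₁, ‖coeff j (C t₁ * padicLFunction f₁ (unitRoot W₁ 2 : ℚ_[2]))‖ ≤ 2⁻¹)
    (hunit₁ : ‖coeff n₁ (C t₁ * padicLFunction f₁ (unitRoot W₁ 2 : ℚ_[2]))‖ = 1)
    (hint₂ : ∀ k, ‖coeff k (C t₂ * padicLFunction f₂ (unitRoot W₂ 2 : ℚ_[2]))‖ ≤ 1)
    (hsmall₂ : ∀ j < n₂, ‖coeff j (C t₂ * padicLFunction f₂ (unitRoot W₂ 2 : ℚ_[2]))‖ ≤ 2⁻¹)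
    (hunit₂ : ‖coeff n₂ (C t₂ * padicLFunction f₂ (unitRoot W₂ 2 : ℚ_[2]))‖ = 1) :
    (Even n₁ ↔ Even n₂) ↔
      ((W₁.conductorNorm ℤ % 8 = 1 ∨ W₁.conductorNorm ℤ % 8 = 7) ↔
        (W₂.conductorNorm ℤ % 8 = 1 ∨ W₂.conductorNorm ℤ % 8 = 7)) := by
  rw [even_firstUnitCoeff_iff_conductorNorm_mod_eight hord₁ hf₁ t₁ hint₁ hsmall₁ hunit₁,
    even_firstUnitCoeff_iff_conductorNorm_mod_eight hord₂ hf₂ t₂ hint₂ hsmall₂ hunit₂]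

end Summit.BirchSwinnertonDyer.Rank1Residual.F1Sign2

end
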